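import Summits.ResolutionOfSingularities.ResolutionOfSingularities.Theorems.FrobeniusClosingSteerPowLimit
import Summits.ResolutionOfSingularities.ResolutionOfSingularities.Theorems.RadicialJungCleanModelsStubFormalFibreReducedStalk
import Literature.AlgebraicGeometry.Resolution.ExcellentRingsEssFiniteType
import Literature.AlgebraicGeometry.Resolution.ExcellentRingsFieldProofs
import HarnessLib

/-!
# Route `RadicialJung`, crux `CleanModels` (stmt-15917): the cleaned order of a non-`p`-th power is bounded (LEMMA E)

Support lemma (OURS) for the research stub `stub_cleanModels` = crux `RadicialJung.CleanModels`
(stmt-ResolutionOfSingularities-15917; the one stub of the registered `DescentPerfectToAll` line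
`via-clean-models`, W8.1), item **K1 / LEMMA E** of `HOME/L/res-L0-w81-pv-2/g3/PROGRAMME-clean-dim2.md`
("excellence ⇒ ν < ∞", the termination input of the dimension-2 cleaning procedure at closed
points), in its sharpest local form and over an ARBITRARY ground field:

* `exists_forall_sub_pow_not_mem_pow_of_isExcellentRing` — in an excellent regular local ring `O`
  of characteristic `p`, an element `u` which is not a `p`-th power IN `O` has BOUNDED CLEANED
  ORDER: for some `n`, `u - c^p ∉ 𝔪^n` for every `c ∈ O` (contrapositive of the W4.1 chain's
  `SwitchingDichotomy.PowLimit.exists_pow_eq_of_forall_exists_sub_pow_mem_pow`: an excellent regular local ring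
  is closed under `𝔪`-adic limits of `p`-th powers — roots are `𝔪`-adically Cauchy since `ord` is a
  valuation, and the completion map is Frobenius-closed by geometric regularity of formal fibres).
* `exists_forall_sub_pow_not_mem_pow_localization` — the same for `B_𝔭`, `B` of finite type over a
  field (`Stacks07QW_field_holds`: such `B` are excellent; localisations of excellent rings are
  excellent).
* `exists_forall_sub_pow_not_mem_pow_stalk` — the same for the local ring `𝒪_{V,v}` at a regular
  point of a scheme locally of finite type over a field (`𝒪_{V,v}` is essentially of finite type
  over `k`, `exists_algebra_essFiniteType_stalk`).

In the cleaning procedure this says: at a regular point `v` and for a representative `u` of the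
radicand class that is not a `p`-th power in `𝒪_{V,v}` (e.g. `u ∉ K(V)^p`), the numbers
`ν_v(u') = sup_c ord_v(u' - c^p)` of all recentred representatives `u' = u - c₀^p` are uniformly
bounded, so "recentre and continue" cannot go on for ever at `v`. Complements
`RadicialJungCleanModelsCodimOneClean.lean` (codimension one: no iteration at all) and
`RadicialJungCleanModelsWoundLocusClosed.lean` (the bad locus is closed and proper). Nothing here is a
statement of Hironaka's manuscript or bears on the summit. [cite: Matsumura1987, §32 p. 260]
[cite: StacksProject, Tag 07QW]
-/

noncomputable section

set_option linter.dupNamespace false -- mandated namespace of this single-conjunct summit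

open CategoryTheory AlgebraicGeometry TopologicalSpace IsLocalRing
open Literature.AlgebraicGeometry.Resolution

namespace Summit.ResolutionOfSingularities.ResolutionOfSingularities.Theorems.RadicialJung.CleanModels

/-- **LEMMA E, local form.** In an excellent regular local ring `O` of prime characteristic `p`,
an element that is not a `p`-th power has bounded cleaned order: `∃ n, ∀ c, u - c^p ∉ 𝔪^n`.
[cite: Matsumura1987, §32 p. 260] -/
theorem exists_forall_sub_pow_not_mem_pow_of_isExcellentRing {O : Type} [CommRing O]
    [IsRegularLocalRing O] (p : ℕ) [Fact p.Prime] [CharP O p] (hO : IsExcellentRing O) (u : O)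
    (hu : ∀ c : O, c ^ p ≠ u) : ∃ n : ℕ, ∀ c : O, u - c ^ p ∉ maximalIdeal O ^ n := by
  by_contra h
  push Not at h
  obtain ⟨c, hc⟩ := SwitchingDichotomy.PowLimit.exists_pow_eq_of_forall_exists_sub_pow_mem_pow p hO u h
  exact hu c hc

/-- **LEMMA E for local rings of algebras of finite type over a field.** For `B` of finite type
over a field `k` of characteristic `p` and a prime `𝔭` with `B_𝔭` regular, an element of `B_𝔭`
which is not a `p`-th power in `B_𝔭` has bounded cleaned order. [cite: StacksProject, Tag 07QW] -/
theorem exists_forall_sub_pow_not_mem_pow_localization {k B : Type} [Field k] [CommRing B]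
    [Algebra k B] [Algebra.FiniteType k B] (p : ℕ) [Fact p.Prime] [CharP k p] (𝔭 : Ideal B)
    [𝔭.IsPrime] [IsRegularLocalRing (Localization.AtPrime 𝔭)] (u : Localization.AtPrime 𝔭)
    (hu : ∀ c : Localization.AtPrime 𝔭, c ^ p ≠ u) :
    ∃ n : ℕ, ∀ c : Localization.AtPrime 𝔭, u - c ^ p ∉ maximalIdeal (Localization.AtPrime 𝔭) ^ n := by
  have hB : IsExcellentRing B := Stacks07QW_field_holds k B inferInstance
  have hO : IsExcellentRing (Localization.AtPrime 𝔭) := hB.of_isLocalization 𝔭.primeCompl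
  haveI : CharP (Localization.AtPrime 𝔭) p :=
    charP_of_injective_algebraMap (algebraMap k (Localization.AtPrime 𝔭)).injective p
  exact exists_forall_sub_pow_not_mem_pow_of_isExcellentRing p hO u hu

/-- **LEMMA E at a regular point of a scheme locally of finite type over a field.** For
`f : V → Spec k` locally of finite type (`char k = p`), a point `v` with `𝒪_{V,v}` regular, and
`u ∈ 𝒪_{V,v}` not a `p`-th power in `𝒪_{V,v}`: `∃ n, ∀ c ∈ 𝒪_{V,v}, u - c^p ∉ 𝔪_v^n`. (`𝒪_{V,v}`
is essentially of finite type over `k`, hence excellent.) [cite: StacksProject, Tag 07QW] -/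
theorem exists_forall_sub_pow_not_mem_pow_stalk {k : Type} [Field k] (p : ℕ) [Fact p.Prime]
    [CharP k p] (V : Scheme.{0}) (f : V ⟶ Spec (.of k)) [LocallyOfFiniteType f] (v : V)
    (hreg : IsRegularLocalRing (V.presheaf.stalk v)) (u : V.presheaf.stalk v)
    (hu : ∀ c : V.presheaf.stalk v, c ^ p ≠ u) :
    ∃ n : ℕ, ∀ c : V.presheaf.stalk v, u - c ^ p ∉ maximalIdeal (V.presheaf.stalk v) ^ n := by
  haveI := hreg
  obtain ⟨alg, hEFT⟩ := exists_algebra_essFiniteType_stalk k V f v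
  letI := alg
  have hk : IsExcellentRing k := Stacks07QW_field_holds k k inferInstance
  have hO : IsExcellentRing (V.presheaf.stalk v) := hk.of_essFiniteType hEFT
  haveI : CharP (V.presheaf.stalk v) p :=
    charP_of_injective_algebraMap (algebraMap k (V.presheaf.stalk v)).injective p
  exact exists_forall_sub_pow_not_mem_pow_of_isExcellentRing p hO u hu

/-- The hypothesis "`u` is not a `p`-th power in `𝒪_{V,v}`" follows from "`u` is not a `p`-th power
in the function field" on an integral scheme (the stalks embed into `K(V)`). [folklore] -/
theorem forall_pow_ne_of_functionField {V : Scheme.{0}} [IsIntegral V] (p : ℕ) (v : V)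
    (u : V.presheaf.stalk v)
    (hu : ∀ c : V.functionField, c ^ p ≠ V.presheaf.stalkSpecializes (genericPoint_specializes v) u) :
    ∀ c : V.presheaf.stalk v, c ^ p ≠ u := by
  intro c hc
  apply hu (V.presheaf.stalkSpecializes (genericPoint_specializes v) c)
  rw [← map_pow, hc]

end Summit.ResolutionOfSingularities.ResolutionOfSingularities.Theorems.RadicialJung.CleanModels

end
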